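import Literature.MathematicalPhysics.QuantumLattice.InfVolFermionStateTwistedFlipAction
import Literature.MathematicalPhysics.QuantumLattice.InfVolFermionStateTTPrimeMeanEnergyBox
import Literature.MathematicalPhysics.QuantumLattice.TIGroundEnergyDensityResponse
import Literature.MathematicalPhysics.QuantumLattice.BdGBondHamiltonianTorus
import HarnessLib

/-!
# Two-site words at the origin (spin-summed hopping, singlet pair): their transforms under the point group,
# the spin exchange, the gauge quarter turns and the translations; the `t–t'` mean energy and the local pair of a
# translation-invariant state through step sums

Topic `Literature/MathematicalPhysics/QuantumLattice` (namespace = path); cell `hubbard-cq`, seat `hubbard-cq-obsth-1`.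
First half of the «WLOG by averaging» licence of the cell's sourced-menu node sentences (sequel:
`DWaveSourceTwistedFlipInvariance`): the bookkeeping that reduces the `D₄ × ℤ₂^{flip} × gauge` covariance of the
three energies to that of two words.
* §1 `hopWord v = H_v = Σ_σ (c†_{0σ} c_{vσ} + c†_{vσ} c_{0σ})` and `singletWord v = b_v = c_{0↑} c_{v↓} − c_{0↓} c_{v↑}` on
  `stepPair v = {0, v}`: `(ω∘γ)(H_v) = ω(H_{γv})`, `(ω∘γ)(b_v) = ω(b_{γv})` (`d4Act`, every state); `F H_v = H_v`,
  `F b_v = −b_v`; `γ_θ H_v = H_v`, `γ_{kπ/2} b_v = (−1)^k b_v`; `ω(H_{−v}) = ω(H_v)`, `ω(b_{−v}) = ω(b_v)` for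
  translation-invariant `ω`.
* §2 the point group permutes `unitSteps`, `diagSteps`, `{0} ∪ unitSteps` (`sum_unitSteps_d4Vec`, …); for
  translation-invariant `ω`: `e^{tt'}(ω) = U·Re ω(n_{0↑}n_{0↓}) − (t/2) Σ_{v ∈ unitSteps} Re ω(H_v) − (t'/2) Σ_{v ∈ diagSteps} Re ω(H_v)`
  (`IsTranslationInvariant.meanEnergy_hubbardTTPrime_eq_stepSums`); for every `ω`:
  `ω(P₀) = Σ_{e ∈ {0} ∪ unitSteps} (g(e)/√2) ω(b_e)` (`expect_localPairAt_eq_sum_singletWord`).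
Everything is PROVED; three abbreviations (`stepPair`, `hopWord`, `singletWord`) have bodies; no named fact, no `sorry`.
Tree search: REUSED `d4Act_expect`, `expect_fermionEmbed_incl_eq`, `shift_expect`, `spinFlip_expect`, `relabel_spinSwap_cAt`,
`gaugeAut_cAt_conjTranspose_mul_cAt`, `hasGaugeCharge_annihilation_mul_annihilation`, `annihilation_singlet_swap`, `sum_unitSteps`,
`IsTranslationInvariant.meanEnergy_hubbardTTPrime_eq/expect_hubbard_meanEnergyObs`, `hubbardFermionInteraction_apply_pair/_singleton`,
`diagHoppingFermionInteraction_apply_pair`, `d4Vec_mem_unitSteps`, `d4Vec_mem_diagSteps_iff`, `d4Vec_injective`;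
`lean search 'd4Act.*(hop|singlet)|stepPair|hopWord'`: nothing.

References: D. J. Scalapino, Phys. Rep. 250 (1995) 329, §2 (the square-lattice point group and bond words) [cite: Scalapino1995, §2];
T. Koma, H. Tasaki, J. Stat. Phys. 76 (1994) 745, §1 (singlet pair field) [cite: KomaTasaki1994, §1]; O. Bratteli, A. Kishimoto,
D. W. Robinson, CMP 64 (1978) 41, §3 (mean energy functional) [cite: BratteliKishimotoRobinson1978, §3]; O. Bratteli,
D. W. Robinson, *OAQSM 1* (1987) §4.3.1 (invariant states) [cite: BratteliRobinsonI1987, §4.3.1].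
-/

noncomputable section

namespace Literature.MathematicalPhysics.QuantumLattice

open Matrix Finset Complex HubbardWave0 Literature.Probability.LatticeModels
open scoped ComplexOrder BigOperators

/-! ## §1 Two-site words at the origin and their transforms -/

section Words

/-- The two-site region `{0, 0 + v}` of the step `v`. [cite: Scalapino1995, §2] -/
abbrev stepPair (v : Site 2) : Finset (Site 2) := {0, 0 + v}

/-- `0 ∈ {0, 0 + v}`. [cite: Scalapino1995, §2] -/
theorem zero_mem_stepPair (v : Site 2) : (0 : Site 2) ∈ stepPair v := mem_insert_self _ _

/-- `0 + v ∈ {0, 0 + v}`. [cite: Scalapino1995, §2] -/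
theorem add_mem_stepPair (v : Site 2) : (0 : Site 2) + v ∈ stepPair v := mem_insert_of_mem (mem_singleton_self _)

/-- **The spin-summed hopping word `H_v = Σ_σ (c†_{0σ} c_{vσ} + c†_{vσ} c_{0σ})`** on `{0, v}` (the bond term of the
nearest-neighbour and diagonal hopping interactions, `Φ^t{0,e_i} = −t H_{e_i}`, `Φ^{t'}{0,j_s} = −t' H_{j_s}`).
[cite: Scalapino1995, §2] -/
abbrev hopWord (v : Site 2) : FermionOp (stepPair v) :=
  ∑ σ : Fin 2, ((cAt 0 (zero_mem_stepPair v) σ)ᴴ * cAt (0 + v) (add_mem_stepPair v) σ +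
    (cAt (0 + v) (add_mem_stepPair v) σ)ᴴ * cAt 0 (zero_mem_stepPair v) σ)

/-- **The singlet pair word `b_v = c_{0↑} c_{v↓} − c_{0↓} c_{v↑}`** on `{0, v}` (`singletPairAt 0 (0+v)`; the bond term
of the pair-source interaction and of the local pair `P₀ = Σ_e (g(e)/√2) b_e`). [cite: KomaTasaki1994, §1] -/
abbrev singletWord (v : Site 2) : FermionOp (stepPair v) :=
  singletPairAt 0 (0 + v) (zero_mem_stepPair v) (add_mem_stepPair v)

/-- `0 ∈ γ{0, 0+v}`. [cite: Scalapino1995, §2] -/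
private theorem zero_mem_d4ShiftSet_stepPair (γ : DihedralGroup 4) (v : Site 2) :
    (0 : Site 2) ∈ d4ShiftSet γ 0 (stepPair v) := by
  have h := d4Vec_add_mem_d4ShiftSet γ 0 (zero_mem_stepPair v)
  rwa [d4Vec_zero, add_zero] at h

/-- `0 + γv ∈ γ{0, 0+v}`. [cite: Scalapino1995, §2] -/
private theorem add_d4Vec_mem_d4ShiftSet_stepPair (γ : DihedralGroup 4) (v : Site 2) :
    (0 : Site 2) + d4Vec γ v ∈ d4ShiftSet γ 0 (stepPair v) := by
  have h := d4Vec_add_mem_d4ShiftSet γ 0 (add_mem_stepPair v)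
  rwa [zero_add, add_zero, ← zero_add (d4Vec γ v)] at h

/-- `{0, 0 + γv} ⊆ γ{0, 0+v}` (in fact equal). [cite: Scalapino1995, §2] -/
private theorem stepPair_d4Vec_subset (γ : DihedralGroup 4) (v : Site 2) :
    stepPair (d4Vec γ v) ⊆ d4ShiftSet γ 0 (stepPair v) :=
  Finset.insert_subset (zero_mem_d4ShiftSet_stepPair γ v)
    (Finset.singleton_subset_iff.2 (add_d4Vec_mem_d4ShiftSet_stepPair γ v))

/-- The generators under `Γ(incl) ∘ Γ(d4Emb γ 0 {0,v})`: `c_{yσ} ↦ c_{γy,σ}`. [cite: BratteliRobinsonII1997, §5.2.2 Thm. 5.2.5] -/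
private theorem fermionEmbed_d4Emb_stepPair_cAt (γ : DihedralGroup 4) (v : Site 2) (y : Site 2) (hy : y ∈ stepPair v)
    (σ : Fin 2) :
    fermionEmbed (PolySite.incl (subset_refl _)) (fermionEmbed (PolySite.d4Emb γ 0 (stepPair v)) (cAt y hy σ)) =
      cAt (d4Vec γ y + 0) (d4Vec_add_mem_d4ShiftSet γ 0 hy) σ := by
  rw [fermionEmbed_fermionEmbed, cAt, fermionEmbed_annihilation]
  rfl

/-- **`(ω ∘ γ)(H_v) = ω(H_{γv})`** for every state and every point operation. [cite: Scalapino1995, §2] -/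
theorem InfVolFermionState.d4Act_expect_hopWord (ω : InfVolFermionState 2) (γ : DihedralGroup 4) (v : Site 2) :
    (ω.d4Act γ).expect (stepPair v) (hopWord v) = ω.expect (stepPair (d4Vec γ v)) (hopWord (d4Vec γ v)) := by
  rw [InfVolFermionState.d4Act_expect]
  refine ω.expect_fermionEmbed_incl_eq (subset_refl _) (stepPair_d4Vec_subset γ v) _ _ ?_
  have h0 : ∀ (h : d4Vec γ 0 + 0 ∈ d4ShiftSet γ 0 (stepPair v)) (σ : Fin 2),
      cAt (d4Vec γ 0 + 0) h σ = cAt 0 (zero_mem_d4ShiftSet_stepPair γ v) σ := fun h σ =>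
    cAt_congr h _ (by rw [d4Vec_zero, add_zero]) σ
  have h1 : ∀ (h : d4Vec γ (0 + v) + 0 ∈ d4ShiftSet γ 0 (stepPair v)) (σ : Fin 2),
      cAt (d4Vec γ (0 + v) + 0) h σ = cAt (0 + d4Vec γ v) (add_d4Vec_mem_d4ShiftSet_stepPair γ v) σ := fun h σ =>
    cAt_congr h _ (by rw [zero_add, add_zero, zero_add]) σ
  simp only [map_sum, map_add, map_mul, fermionEmbed_conjTranspose, fermionEmbed_d4Emb_stepPair_cAt,
    fermionEmbed_incl_cAt, h0, h1]

/-- **`(ω ∘ γ)(b_v) = ω(b_{γv})`** for every state and every point operation. [cite: Scalapino1995, §2] -/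
theorem InfVolFermionState.d4Act_expect_singletWord (ω : InfVolFermionState 2) (γ : DihedralGroup 4) (v : Site 2) :
    (ω.d4Act γ).expect (stepPair v) (singletWord v) = ω.expect (stepPair (d4Vec γ v)) (singletWord (d4Vec γ v)) := by
  rw [InfVolFermionState.d4Act_expect]
  refine ω.expect_fermionEmbed_incl_eq (subset_refl _) (stepPair_d4Vec_subset γ v) _ _ ?_
  have h0 : ∀ (h : d4Vec γ 0 + 0 ∈ d4ShiftSet γ 0 (stepPair v)) (σ : Fin 2),
      cAt (d4Vec γ 0 + 0) h σ = cAt 0 (zero_mem_d4ShiftSet_stepPair γ v) σ := fun h σ =>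
    cAt_congr h _ (by rw [d4Vec_zero, add_zero]) σ
  have h1 : ∀ (h : d4Vec γ (0 + v) + 0 ∈ d4ShiftSet γ 0 (stepPair v)) (σ : Fin 2),
      cAt (d4Vec γ (0 + v) + 0) h σ = cAt (0 + d4Vec γ v) (add_d4Vec_mem_d4ShiftSet_stepPair γ v) σ := fun h σ =>
    cAt_congr h _ (by rw [zero_add, add_zero, zero_add]) σ
  simp only [map_sub, map_mul, fermionEmbed_d4Emb_stepPair_cAt, fermionEmbed_incl_cAt, h0, h1]

/-- `F H_v = H_v` (the hopping word is spin symmetric). [cite: Han2020Bootstrap, §3] -/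
theorem relabel_spinSwap_hopWord (v : Site 2) :
    relabel (Orb.spinSwap : Orb (PolySite (stepPair v)) ≃ Orb (PolySite (stepPair v))) (hopWord v) = hopWord v := by
  simp only [map_add, map_mul, relabel_conjTranspose, InfVolFermionState.relabel_spinSwap_cAt, Fin.sum_univ_two,
    Fin.isValue, Equiv.swap_apply_left, Equiv.swap_apply_right]
  exact add_comm _ _

/-- `F b_v = −b_v` (the singlet is odd under the spin exchange of its letters). [cite: Han2020Bootstrap, §3] -/
theorem relabel_spinSwap_singletWord (v : Site 2) :
    relabel (Orb.spinSwap : Orb (PolySite (stepPair v)) ≃ Orb (PolySite (stepPair v))) (singletWord v) = -singletWord v := by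
  simp only [map_sub, map_mul, InfVolFermionState.relabel_spinSwap_cAt, Fin.isValue, Equiv.swap_apply_left,
    Equiv.swap_apply_right, neg_sub]

/-- **`(Fω)(H_v) = ω(H_v)`**. [cite: Han2020Bootstrap, §3] -/
theorem InfVolFermionState.spinFlip_expect_hopWord (ω : InfVolFermionState 2) (v : Site 2) :
    ω.spinFlip.expect (stepPair v) (hopWord v) = ω.expect (stepPair v) (hopWord v) := by
  rw [InfVolFermionState.spinFlip_expect, relabel_spinSwap_hopWord]

/-- **`(Fω)(b_v) = −ω(b_v)`**. [cite: Han2020Bootstrap, §3] -/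
theorem InfVolFermionState.spinFlip_expect_singletWord (ω : InfVolFermionState 2) (v : Site 2) :
    ω.spinFlip.expect (stepPair v) (singletWord v) = -ω.expect (stepPair v) (singletWord v) := by
  rw [InfVolFermionState.spinFlip_expect, relabel_spinSwap_singletWord, map_neg]

/-- `F^k H_v = H_v`. [cite: Han2020Bootstrap, §3] -/
theorem spinSwapIter_hopWord (k : ℕ) (v : Site 2) : spinSwapIter k (hopWord v) = hopWord v := by
  induction k with
  | zero => rfl
  | succ k ih => rw [spinSwapIter_succ, ih, relabel_spinSwap_hopWord]

/-- `F^k b_v = (−1)^k b_v`. [cite: Han2020Bootstrap, §3] -/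
theorem spinSwapIter_singletWord (k : ℕ) (v : Site 2) : spinSwapIter k (singletWord v) = ((-1 : ℂ) ^ k) • singletWord v := by
  induction k with
  | zero => rw [spinSwapIter_zero, pow_zero, one_smul]
  | succ k ih => rw [spinSwapIter_succ, ih, map_smul, relabel_spinSwap_singletWord, smul_neg, pow_succ, mul_comm,
      ← smul_smul, neg_one_smul]

/-- `γ_θ H_v = H_v` (the hopping word is gauge invariant). [cite: BratteliRobinsonII1997, §5.2.2] -/
theorem gaugeAut_hopWord (θ : ℝ) (v : Site 2) : gaugeAut θ (hopWord v) = hopWord v := by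
  simp only [map_sum, map_add, gaugeAut_cAt_conjTranspose_mul_cAt]

/-- `b_v` has gauge charge `−2`. [cite: BratteliRobinsonII1997, §5.2.2] -/
theorem hasGaugeCharge_singletWord (v : Site 2) : HasGaugeCharge (-2) (singletWord v) :=
  (hasGaugeCharge_annihilation_mul_annihilation _ _).sub (hasGaugeCharge_annihilation_mul_annihilation _ _)

/-- **`γ_{kπ/2} b_v = (−1)^k b_v`** (charge `−2`: `e^{−2i·kπ/2} = (−1)^k`). [cite: BratteliRobinsonII1997, §5.2.2] -/
theorem gaugeAut_natCast_mul_pi_div_two_singletWord (k : ℕ) (v : Site 2) :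
    gaugeAut ((k : ℝ) * (Real.pi / 2)) (singletWord v) = ((-1 : ℂ) ^ k) • singletWord v := by
  rw [hasGaugeCharge_singletWord v ((k : ℝ) * (Real.pi / 2))]
  congr 1
  rw [show I * (((k : ℝ) * (Real.pi / 2) : ℝ) : ℂ) * ((-2 : ℤ) : ℂ) = (k : ℂ) * (-(Real.pi * I)) by push_cast; ring,
    Complex.exp_nat_mul, Complex.exp_neg, Complex.exp_pi_mul_I, inv_neg, inv_one]

end Words

/-! ### Translation invariance: the words at `−v` and at `v` have the same expectation -/

section Translation

/-- `{0, −v} + v ⊆ {0, v}`. [cite: ArakiMoriya2003, §4.1 Def. 4.3] -/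
private theorem shiftSet_stepPair_neg_subset (v : Site 2) : shiftSet v (stepPair (-v)) ⊆ stepPair v := by
  intro x hx
  rw [mem_shiftSet, Finset.mem_insert, Finset.mem_singleton] at hx
  rw [Finset.mem_insert, Finset.mem_singleton]
  rcases hx with h | h
  · exact Or.inr (sub_eq_iff_eq_add.1 h)
  · refine Or.inl ?_
    rw [sub_eq_iff_eq_add.1 h, zero_add, neg_add_cancel]

/-- The generators under the translation by `v` followed by the inclusion into `{0, v}`. [cite: ArakiMoriya2003, §4.1 Def. 4.3] -/
private theorem fermionEmbed_shiftEmb_stepPair_cAt (v : Site 2) (y : Site 2) (hy : y ∈ stepPair (-v)) (σ : Fin 2) :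
    fermionEmbed ((PolySite.shiftEmb v (stepPair (-v))).trans (PolySite.incl (shiftSet_stepPair_neg_subset v)))
        (cAt y hy σ) = cAt (y + v) (shiftSet_stepPair_neg_subset v (PolySite.add_mem_shiftSet v hy)) σ := by
  rw [cAt, fermionEmbed_annihilation]
  rfl

variable {ω : InfVolFermionState 2}

/-- **`ω(H_{−v}) = ω(H_v)` for translation-invariant `ω`** (the bond `{0, −v}` is the translate of `{v, 0}`).
[cite: BratteliRobinsonI1987, §4.3.1] -/
theorem InfVolFermionState.IsTranslationInvariant.expect_hopWord_neg (hω : ω.IsTranslationInvariant) (v : Site 2) :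
    ω.expect (stepPair (-v)) (hopWord (-v)) = ω.expect (stepPair v) (hopWord v) := by
  conv_lhs => rw [← hω v, InfVolFermionState.shift_expect]
  refine ω.expect_fermionEmbed_incl_eq (shiftSet_stepPair_neg_subset v) (subset_refl _) _ _ ?_
  have h0 : ∀ (h : (0 : Site 2) + v ∈ stepPair v) (σ : Fin 2), cAt (0 + v) h σ = cAt (0 + v) (add_mem_stepPair v) σ :=
    fun h σ => rfl
  have h1 : ∀ (h : (0 : Site 2) + -v + v ∈ stepPair v) (σ : Fin 2), cAt (0 + -v + v) h σ = cAt 0 (zero_mem_stepPair v) σ :=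
    fun h σ => cAt_congr h _ (by rw [zero_add, neg_add_cancel]) σ
  simp only [map_sum, map_add, map_mul, fermionEmbed_conjTranspose, fermionEmbed_fermionEmbed,
    fermionEmbed_shiftEmb_stepPair_cAt, fermionEmbed_incl_cAt, h0, h1]
  exact Finset.sum_congr rfl fun σ _ => add_comm _ _

/-- **`ω(b_{−v}) = ω(b_v)` for translation-invariant `ω`** (translate by `v`; the singlet is symmetric,
`b_{v,0} = b_{0,v}`). [cite: BratteliRobinsonI1987, §4.3.1] -/
theorem InfVolFermionState.IsTranslationInvariant.expect_singletWord_neg (hω : ω.IsTranslationInvariant) (v : Site 2) :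
    ω.expect (stepPair (-v)) (singletWord (-v)) = ω.expect (stepPair v) (singletWord v) := by
  conv_lhs => rw [← hω v, InfVolFermionState.shift_expect]
  refine ω.expect_fermionEmbed_incl_eq (shiftSet_stepPair_neg_subset v) (subset_refl _) _ _ ?_
  have h0 : ∀ (h : (0 : Site 2) + v ∈ stepPair v) (σ : Fin 2), cAt (0 + v) h σ = cAt (0 + v) (add_mem_stepPair v) σ :=
    fun h σ => rfl
  have h1 : ∀ (h : (0 : Site 2) + -v + v ∈ stepPair v) (σ : Fin 2), cAt (0 + -v + v) h σ = cAt 0 (zero_mem_stepPair v) σ :=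
    fun h σ => cAt_congr h _ (by rw [zero_add, neg_add_cancel]) σ
  simp only [map_sub, map_mul, fermionEmbed_fermionEmbed, fermionEmbed_shiftEmb_stepPair_cAt, fermionEmbed_incl_cAt,
    h0, h1]
  exact annihilation_singlet_swap _ _

end Translation

/-! ## §2 Step sums: the point group permutes the steps; the energies of a translation-invariant state -/

section StepSums

/-- **`Σ_{v ∈ unitSteps} F(γv) = Σ_{v ∈ unitSteps} F(v)`**: the point group permutes `{±e₁, ±e₂}`. [cite: Scalapino1995, §2] -/
theorem sum_unitSteps_d4Vec {M : Type*} [AddCommMonoid M] (γ : DihedralGroup 4) (F : Site 2 → M) :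
    ∑ v ∈ unitSteps, F (d4Vec γ v) = ∑ v ∈ unitSteps, F v := by
  have himg : unitSteps.image (d4Vec γ) = unitSteps :=
    Finset.eq_of_subset_of_card_le (Finset.image_subset_iff.2 fun v hv => d4Vec_mem_unitSteps γ hv)
      (by rw [Finset.card_image_of_injective _ (d4Vec_injective γ)])
  rw [← Finset.sum_image fun x _ y _ h => d4Vec_injective γ h, himg]

/-- **`Σ_{v ∈ diagSteps} F(γv) = Σ_{v ∈ diagSteps} F(v)`**: the point group permutes `{±(e₁+e₂), ±(e₁−e₂)}`. [cite: Scalapino1995, §2] -/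
theorem sum_diagSteps_d4Vec {M : Type*} [AddCommMonoid M] (γ : DihedralGroup 4) (F : Site 2 → M) :
    ∑ v ∈ diagSteps, F (d4Vec γ v) = ∑ v ∈ diagSteps, F v := by
  have himg : diagSteps.image (d4Vec γ) = diagSteps :=
    Finset.eq_of_subset_of_card_le (Finset.image_subset_iff.2 fun v hv => (d4Vec_mem_diagSteps_iff γ v).2 hv)
      (by rw [Finset.card_image_of_injective _ (d4Vec_injective γ)])
  rw [← Finset.sum_image fun x _ y _ h => d4Vec_injective γ h, himg]

/-- **`Σ_{e ∈ {0} ∪ unitSteps} F(γe) = Σ_{e ∈ {0} ∪ unitSteps} F(e)`** (`γ0 = 0`). [cite: Scalapino1995, §2] -/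
theorem sum_insert_zero_unitSteps_d4Vec {M : Type*} [AddCommMonoid M] (γ : DihedralGroup 4) (F : Site 2 → M) :
    ∑ v ∈ insert (0 : Site 2) unitSteps, F (d4Vec γ v) = ∑ v ∈ insert (0 : Site 2) unitSteps, F v := by
  rw [Finset.sum_insert zero_not_mem_unitSteps, Finset.sum_insert zero_not_mem_unitSteps, d4Vec_zero, sum_unitSteps_d4Vec]

/-- A sum over the four diagonal steps `{(1,1), (−1,−1), (1,−1), (−1,1)}`, expanded. [cite: XuEtAl2024, eq. (1)] -/
theorem sum_diagSteps_expand {M : Type*} [AddCommMonoid M] (f : Site 2 → M) :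
    ∑ e ∈ diagSteps, f e = f ![1, 1] + (f ![-1, -1] + (f ![1, -1] + f ![-1, 1])) := by
  have h1 : (![1, 1] : Site 2) ∉ ({![-1, -1], ![1, -1], ![-1, 1]} : Finset (Site 2)) := by decide
  have h2 : (![-1, -1] : Site 2) ∉ ({![1, -1], ![-1, 1]} : Finset (Site 2)) := by decide
  have h3 : (![1, -1] : Site 2) ∉ ({![-1, 1]} : Finset (Site 2)) := by decide
  rw [diagSteps, Finset.sum_insert h1, Finset.sum_insert h2, Finset.sum_insert h3, Finset.sum_singleton]

/-- `diagVec 0 = (1,1)`, `−diagVec 0 = (−1,−1)`, `diagVec 1 = (1,−1)`, `−diagVec 1 = (−1,1)`. [cite: XuEtAl2024, eq. (1)] -/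
theorem diagVec_eq_and : diagVec 0 = ![1, 1] ∧ -diagVec 0 = ![-1, -1] ∧ diagVec 1 = ![1, -1] ∧ -diagVec 1 = ![-1, 1] := by
  refine ⟨?_, ?_, ?_, ?_⟩ <;> (ext i; fin_cases i <;> simp [diagVec])

variable {ω : InfVolFermionState 2}

/-- **The `t–t'` mean energy of a translation-invariant state through the step sums**:
`e^{tt'}(ω) = U·Re ω(n_{0↑}n_{0↓}) − (t/2) Σ_{v ∈ unitSteps} Re ω(H_v) − (t'/2) Σ_{v ∈ diagSteps} Re ω(H_v)`
(each bond through the origin appears with both orientations). [cite: BratteliKishimotoRobinson1978, §3 (mean energy functional)] -/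
theorem InfVolFermionState.IsTranslationInvariant.meanEnergy_hubbardTTPrime_eq_stepSums (hω : ω.IsTranslationInvariant)
    (t t' U : ℝ) :
    ω.meanEnergy (hubbardTTPrimeFermionInteraction t t' U) 1 =
      U * (ω.expect ({0} : Finset (Site 2)) (nAt 0 (mem_singleton_self 0) 0 * nAt 0 (mem_singleton_self 0) 1)).re -
        t / 2 * ∑ v ∈ unitSteps, (ω.expect (stepPair v) (hopWord v)).re -
        t' / 2 * ∑ v ∈ diagSteps, (ω.expect (stepPair v) (hopWord v)).re := by
  have hnn : ∀ i : Fin 2, (ω.expect {0, 0 + unitVec i} ((hubbardFermionInteraction 2 t U).Φ {0, 0 + unitVec i})).re =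
      -t * (ω.expect (stepPair (unitVec i)) (hopWord (unitVec i))).re := by
    intro i
    rw [hubbardFermionInteraction_apply_pair, map_smul, smul_eq_mul, neg_mul, Complex.neg_re, Complex.re_ofReal_mul, neg_mul]
  have hdd : ∀ s : Fin 2, (ω.expect {0, 0 + diagVec s} ((diagHoppingFermionInteraction t').Φ {0, 0 + diagVec s})).re =
      -t' * (ω.expect (stepPair (diagVec s)) (hopWord (diagVec s))).re := by
    intro s
    rw [diagHoppingFermionInteraction_apply_pair, map_smul, smul_eq_mul, neg_mul, Complex.neg_re, Complex.re_ofReal_mul, neg_mul]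
  have h00 : (ω.expect ({0} : Finset (Site 2)) ((hubbardFermionInteraction 2 t U).Φ {0})).re =
      U * (ω.expect ({0} : Finset (Site 2)) (nAt 0 (mem_singleton_self 0) 0 * nAt 0 (mem_singleton_self 0) 1)).re := by
    rw [hubbardFermionInteraction_apply_singleton, map_smul, smul_eq_mul, Complex.re_ofReal_mul]
  -- the four-step sums through the two positive steps
  set F : Site 2 → ℝ := fun v => (ω.expect (stepPair v) (hopWord v)).re with hF
  have hFneg : ∀ v : Site 2, F (-v) = F v := fun v => by rw [hF]; dsimp only; rw [hω.expect_hopWord_neg v]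
  have hU : ∑ v ∈ unitSteps, F v = 2 * (F (unitVec 0) + F (unitVec 1)) := by
    rw [sum_unitSteps, hFneg, hFneg, unitVec, unitVec]; ring
  have hD : ∑ v ∈ diagSteps, F v = 2 * (F (diagVec 0) + F (diagVec 1)) := by
    obtain ⟨h0, h0', h1, h1'⟩ := diagVec_eq_and
    rw [sum_diagSteps_expand, ← h0, ← h0', ← h1, ← h1', hFneg, hFneg]; ring
  rw [hω.meanEnergy_hubbardTTPrime_eq t' t U, InfVolFermionState.hubbardEnergyDensity, InfVolFermionState.meanEnergy,
    hω.expect_hubbard_meanEnergyObs t U, Complex.add_re, Complex.re_sum, h00, hU, hD, Fin.sum_univ_two, Fin.sum_univ_two,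
    hnn, hnn, hdd, hdd]
  ring

/-- `{0, e} ⊆ pairRegion ({0} ∪ unitSteps) 0` for `e ∈ {0} ∪ unitSteps`. [cite: KomaTasaki1994, §1] -/
theorem stepPair_subset_pairRegion {e : Site 2} (he : e ∈ insert (0 : Site 2) unitSteps) :
    stepPair e ⊆ pairRegion (insert (0 : Site 2) unitSteps) 0 :=
  Finset.insert_subset (self_mem_pairRegion _ 0) (Finset.singleton_subset_iff.2 (add_mem_pairRegion 0 he))

/-- **The local pair through the singlet words**: `ω(P₀) = Σ_{e ∈ {0} ∪ unitSteps} (g(e)/√2) ω(b_e)` for EVERY state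
(`P₀ = localPairAt ({0} ∪ unitSteps) g 0`). [cite: KomaTasaki1994, §1] -/
theorem InfVolFermionState.expect_localPairAt_eq_sum_singletWord (ω : InfVolFermionState 2) (g : Site 2 → ℝ) :
    ω.expect (pairRegion (insert (0 : Site 2) unitSteps) 0) (localPairAt (insert (0 : Site 2) unitSteps) g 0) =
      ∑ e ∈ insert (0 : Site 2) unitSteps, ((g e / Real.sqrt 2 : ℝ) : ℂ) * ω.expect (stepPair e) (singletWord e) := by
  have hP : localPairAt (insert (0 : Site 2) unitSteps) g 0 =
      ∑ e ∈ (insert (0 : Site 2) unitSteps).attach, ((g e.1 / Real.sqrt 2 : ℝ) : ℂ) •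
        singletPairAt 0 (0 + e.1) (self_mem_pairRegion _ 0) (add_mem_pairRegion 0 e.2) := rfl
  have hb : ∀ e : ↥(insert (0 : Site 2) unitSteps), ω.expect (pairRegion (insert (0 : Site 2) unitSteps) 0)
      (singletPairAt 0 (0 + e.1) (self_mem_pairRegion _ 0) (add_mem_pairRegion 0 e.2)) =
      ω.expect (stepPair e.1) (singletWord e.1) := by
    intro e
    rw [← ω.compatible (stepPair_subset_pairRegion e.2)]
    simp only [map_sub, map_mul, fermionEmbed_incl_cAt]
  rw [hP, map_sum, ← Finset.sum_attach (insert (0 : Site 2) unitSteps)]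
  exact Finset.sum_congr rfl fun e _ => by rw [map_smul, smul_eq_mul, hb]

end StepSums

end Literature.MathematicalPhysics.QuantumLattice

end
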